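import Literature.Probability.LatticeModels.DirichletGreenFunction
import HarnessLib

/-!
# Poisson extensions, hitting and escape probabilities of the killed walk, and the last-exit decomposition

Topic `Literature/Probability/LatticeModels` (discrete potential theory on `ℤ^d`, companion of
`DirichletGreenFunction.lean`: `G_Λ = dirichletGreen Λ` (`= ¼ ×` expected visits for `d = 2`),
`H_Λ = poissonKernel Λ` (exit distribution of the walk killed on leaving the finite set `Λ`)).
The analytic toolkit behind Chapter 2 of G. F. Lawler, *Intersections of Random Walks* (1991)
("capacity, … escape probabilities") in the tree's matrix/Green-function language — no path space:

* `poissonExt Λ g` — the **Poisson extension** `x ↦ ∑_{z ∈ ∂Λ} H_Λ(x,z) g(z)` on `Λ`, `g` off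
  `Λ`; it is THE harmonic extension of `g` (`isZdHarmonicOn_poissonExt`,
  `IsZdHarmonicOn.eq_poissonExt`: a harmonic function on `Λ` is the Poisson extension of its own
  values — Lawler 1991, §1.4 gives the probabilistic form `f(x) = E^x f(S_τ)`), with the
  comparison `poissonExt_le_poissonExt` and two-sided bounds;
* `poissonKernel_decomp` — **exit distributions factor through a subdomain** (strong Markov
  property at the exit time of `D ⊆ Λ`):
  `H_Λ(x,z) = ∑_{w ∈ ∂D} H_D(x,w) · (H_Λ(w,z) if w ∈ Λ, δ_{wz} if w ∉ Λ)`;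
* `hitBeforeExit Λ V x` — **`P^x{T_V < τ_Λ}`**, the probability that the walk from `x` visits `V` before
  leaving `Λ` (`= ∑_{v ∈ V} H_{Λ∖V}(x,v)` off `V`, `1` on `V`), and `exitBeforeHit = 1 - hitBeforeExit`
  (`= P^x{τ_Λ < T_V}`, Lawler's `e(x, A)` for `x ∉ A`); harmonic on `Λ ∖ V`, between `0` and `1`,
  **monotone** (`exitBeforeHit_mono`: enlarging the domain or the obstacle decreases the escape
  probability);
* `hitBeforeExit_eq_sum_dirichletGreen_mul` — the **last-exit decomposition** (Lawler 1991,
  Prop. 2.4.1(c), "`P^x{τ_A < ξ} = ∑_{y ∈ A} G(x,y) P^y{τ_A > ξ}`", here with Lawler's return time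
  `τ_A = inf{j ≥ 1 : S_j ∈ A}`): for `V ⊆ Λ` and `x ∈ Λ`,
  `hitBeforeExit Λ V x = ∑_{y ∈ V} G_Λ(x,y) · ∑_{w ∼ y} exitBeforeHit Λ V w`
  (`¼ ∑_{w ∼ y} exitBeforeHit Λ V w = P^y{τ_Λ < τ_V⁺}` is the escape probability from `y ∈ V` with
  the RETURN time to `V`; the factor `4` is absorbed in `G_Λ = ¼ E[visits]`). Proof: both sides
  vanish off `Λ` and have the same Laplacian `-𝟙_V(x) ∑_{w∼x} exitBeforeHit(w)` on `Λ`.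

Everything here is proved; no named fact is introduced.

## References

* G. F. Lawler, *Intersections of Random Walks*, Birkhäuser (1991), §1.4 (Dirichlet problem,
  `f(x) = E^x f(S_τ)`), §2.2 and Prop. 2.4.1 (last-exit decomposition) [Lawler1991].
-/

noncomputable section

namespace Literature.Probability.LatticeModels

open Finset

variable {d : ℕ}

/-! ### The Poisson extension of boundary data -/

/-- The **Poisson extension** of `g` into the finite set `Λ`: `∑_{z ∈ ∂Λ} H_Λ(x,z) g(z)` for
`x ∈ Λ`, and `g x` for `x ∉ Λ` (`= E^x[g(S_{τ_Λ})]`). [cite: Lawler1991, §1.4, p. 23] -/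
def poissonExt (Λ : Finset (Site d)) (g : Site d → ℝ) (x : Site d) : ℝ :=
  if x ∈ Λ then ∑ z ∈ outerBoundary (zdGraph d) Λ, poissonKernel Λ x z * g z else g x

/-- `poissonExt` on `Λ`. [folklore] -/
theorem poissonExt_of_mem {Λ : Finset (Site d)} (g : Site d → ℝ) {x : Site d} (hx : x ∈ Λ) :
    poissonExt Λ g x = ∑ z ∈ outerBoundary (zdGraph d) Λ, poissonKernel Λ x z * g z := by
  rw [poissonExt, if_pos hx]

/-- `poissonExt` off `Λ`. [folklore] -/
theorem poissonExt_of_not_mem {Λ : Finset (Site d)} (g : Site d → ℝ) {x : Site d} (hx : x ∉ Λ) :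
    poissonExt Λ g x = g x := by
  rw [poissonExt, if_neg hx]

/-- **A harmonic function on `Λ` is the Poisson extension of its own values**:
`h x = ∑_{z ∈ ∂Λ} H_Λ(x,z) h z` for `x ∈ Λ` (Green's representation formula with `Δh = 0`;
Lawler 1991, §1.4: `f(x) = E^x f(S_τ)`). [cite: Lawler1991, §1.4, p. 23] -/
theorem IsZdHarmonicOn.eq_sum_poissonKernel (hd : 0 < d) {Λ : Finset (Site d)} {h : Site d → ℝ}
    (hh : IsZdHarmonicOn h (↑Λ : Set (Site d))) {x : Site d} (hx : x ∈ Λ) :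
    h x = ∑ z ∈ outerBoundary (zdGraph d) Λ, poissonKernel Λ x z * h z := by
  have hrep := green_representation hd Λ h hx
  have h0 : ∑ y ∈ Λ, dirichletGreen Λ x y * -latticeLaplacianZd h y = 0 :=
    Finset.sum_eq_zero fun y hy => by rw [hh y (Finset.mem_coe.2 hy), neg_zero, mul_zero]
  rw [h0, zero_add] at hrep
  exact hrep

/-- A harmonic function on `Λ` equals the Poisson extension of itself everywhere. [folklore] -/
theorem IsZdHarmonicOn.eq_poissonExt (hd : 0 < d) {Λ : Finset (Site d)} {h : Site d → ℝ}
    (hh : IsZdHarmonicOn h (↑Λ : Set (Site d))) (x : Site d) : h x = poissonExt Λ h x := by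
  by_cases hx : x ∈ Λ
  · rw [poissonExt_of_mem h hx]; exact hh.eq_sum_poissonKernel hd hx
  · rw [poissonExt_of_not_mem h hx]

/-- The Poisson extension only sees the values of `g` on `∂Λ` (on `Λ`). [folklore] -/
theorem poissonExt_congr_of_mem {Λ : Finset (Site d)} {g g' : Site d → ℝ}
    (hgg' : ∀ z ∈ outerBoundary (zdGraph d) Λ, g z = g' z) {x : Site d} (hx : x ∈ Λ) :
    poissonExt Λ g x = poissonExt Λ g' x := by
  rw [poissonExt_of_mem g hx, poissonExt_of_mem g' hx]
  exact Finset.sum_congr rfl fun z hz => by rw [hgg' z hz]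

/-- **The Poisson extension is harmonic on `Λ`** (`d ≥ 1`): it coincides with the harmonic
extension of `g`, which exists (`exists_isZdHarmonicOn_eq_off`) and is represented by its boundary
values (`IsZdHarmonicOn.eq_sum_poissonKernel`). [cite: Lawler1991, §1.4, p. 23] -/
theorem isZdHarmonicOn_poissonExt (hd : 0 < d) (Λ : Finset (Site d)) (g : Site d → ℝ) :
    IsZdHarmonicOn (poissonExt Λ g) (↑Λ : Set (Site d)) := by
  obtain ⟨u, hu, hoff⟩ := exists_isZdHarmonicOn_eq_off hd Λ.finite_toSet g
  have heq : poissonExt Λ g = u := by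
    funext x
    by_cases hx : x ∈ Λ
    · rw [poissonExt_of_mem g hx, hu.eq_sum_poissonKernel hd hx]
      refine Finset.sum_congr rfl fun z hz => ?_
      rw [hoff z (fun h => (mem_outerBoundary_iff.1 hz).1 h)]
    · rw [poissonExt_of_not_mem g hx, hoff x (fun h => hx h)]
  rw [heq]
  exact hu

/-- **Comparison of Poisson extensions**: `g ≤ g'` on `∂Λ` gives `poissonExt Λ g ≤ poissonExt Λ g'`
on `Λ` (`H_Λ ≥ 0`). [folklore] -/
theorem poissonExt_le_poissonExt (hd : 0 < d) {Λ : Finset (Site d)} {g g' : Site d → ℝ}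
    (hgg' : ∀ z ∈ outerBoundary (zdGraph d) Λ, g z ≤ g' z) {x : Site d} (hx : x ∈ Λ) :
    poissonExt Λ g x ≤ poissonExt Λ g' x := by
  rw [poissonExt_of_mem g hx, poissonExt_of_mem g' hx]
  exact Finset.sum_le_sum fun z hz =>
    mul_le_mul_of_nonneg_left (hgg' z hz) (poissonKernel_nonneg hd Λ x z)

/-- **Upper bound**: `g ≤ M` on `∂Λ` gives `poissonExt Λ g ≤ M` on `Λ` (`∑_z H_Λ(x,z) = 1`).
[folklore] -/
theorem poissonExt_le {Λ : Finset (Site d)} (hd : 0 < d) {g : Site d → ℝ} {M : ℝ}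
    (hg : ∀ z ∈ outerBoundary (zdGraph d) Λ, g z ≤ M) {x : Site d} (hx : x ∈ Λ) :
    poissonExt Λ g x ≤ M := by
  rw [poissonExt_of_mem g hx]
  calc ∑ z ∈ outerBoundary (zdGraph d) Λ, poissonKernel Λ x z * g z
      ≤ ∑ z ∈ outerBoundary (zdGraph d) Λ, poissonKernel Λ x z * M :=
        Finset.sum_le_sum fun z hz => mul_le_mul_of_nonneg_left (hg z hz) (poissonKernel_nonneg hd Λ x z)
    _ = M := by rw [← Finset.sum_mul, sum_poissonKernel hd Λ hx, one_mul]

/-- **Lower bound**: `M ≤ g` on `∂Λ` gives `M ≤ poissonExt Λ g` on `Λ`. [folklore] -/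
theorem le_poissonExt {Λ : Finset (Site d)} (hd : 0 < d) {g : Site d → ℝ} {M : ℝ}
    (hg : ∀ z ∈ outerBoundary (zdGraph d) Λ, M ≤ g z) {x : Site d} (hx : x ∈ Λ) :
    M ≤ poissonExt Λ g x := by
  rw [poissonExt_of_mem g hx]
  calc M = ∑ z ∈ outerBoundary (zdGraph d) Λ, poissonKernel Λ x z * M := by
        rw [← Finset.sum_mul, sum_poissonKernel hd Λ hx, one_mul]
    _ ≤ ∑ z ∈ outerBoundary (zdGraph d) Λ, poissonKernel Λ x z * g z :=
        Finset.sum_le_sum fun z hz => mul_le_mul_of_nonneg_left (hg z hz) (poissonKernel_nonneg hd Λ x z)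

/-- The Poisson extension of nonnegative data is nonnegative. [folklore] -/
theorem poissonExt_nonneg {Λ : Finset (Site d)} (hd : 0 < d) {g : Site d → ℝ} (hg : ∀ z, 0 ≤ g z)
    (x : Site d) : 0 ≤ poissonExt Λ g x := by
  by_cases hx : x ∈ Λ
  · exact le_poissonExt hd (fun z _ => hg z) hx
  · rw [poissonExt_of_not_mem g hx]; exact hg x

/-! ### The Poisson kernel as a Poisson extension; factorisation through a subdomain -/

/-- The Poisson kernel `x ↦ H_Λ(x,z)` (`z ∉ Λ`), extended by `δ_z` off `Λ`, is the Poisson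
extension of `δ_z`. [folklore] -/
theorem poissonExt_indicator_eq {Λ : Finset (Site d)} {z : Site d} (hz : z ∉ Λ) (x : Site d) :
    poissonExt Λ (fun w => if w = z then 1 else 0) x =
      if x ∈ Λ then poissonKernel Λ x z else (if x = z then 1 else 0) := by
  classical
  by_cases hx : x ∈ Λ
  · rw [poissonExt_of_mem _ hx, if_pos hx]
    by_cases hzb : z ∈ outerBoundary (zdGraph d) Λ
    · rw [Finset.sum_eq_single_of_mem z hzb fun w _ hwz => by rw [if_neg hwz, mul_zero]]
      rw [if_pos rfl, mul_one]
    · rw [Finset.sum_eq_zero fun w hw => by rw [if_neg (by rintro rfl; exact hzb hw), mul_zero]]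
      -- `z ∉ Λ ∪ ∂Λ`: no neighbour of `z` lies in `Λ`, so `H_Λ(x,z) = 0`
      unfold poissonKernel
      rw [if_neg hz]
      symm
      refine Finset.sum_eq_zero fun w hw => dirichletGreen_of_not_mem_right Λ x fun hwΛ => hzb ?_
      rw [mem_outerBoundary_iff]
      exact ⟨hz, w, hwΛ, (SimpleGraph.mem_neighborFinset _ _ _).1 hw⟩
  · rw [poissonExt_of_not_mem _ hx, if_neg hx]

/-- **`x ↦ H_Λ(x,z)` is harmonic on `Λ`** (extended by `δ_z` off `Λ`; `z ∉ Λ`, `d ≥ 1`).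
[cite: Lawler1991, §1.4, p. 21] -/
theorem isZdHarmonicOn_poissonKernel (hd : 0 < d) (Λ : Finset (Site d)) {z : Site d} (hz : z ∉ Λ) :
    IsZdHarmonicOn (fun x => if x ∈ Λ then poissonKernel Λ x z else (if x = z then 1 else 0))
      (↑Λ : Set (Site d)) := by
  have h := isZdHarmonicOn_poissonExt hd Λ (fun w => if w = z then 1 else 0)
  have heq : poissonExt Λ (fun w => if w = z then 1 else 0) =
      fun x => if x ∈ Λ then poissonKernel Λ x z else (if x = z then 1 else 0) :=
    funext fun x => poissonExt_indicator_eq hz x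
  rwa [heq] at h

/-- **Exit distributions factor through a subdomain** (the strong Markov property at the exit
time of `D ⊆ Λ`): for `x ∈ D` and `z ∉ Λ`,
`H_Λ(x,z) = ∑_{w ∈ ∂D} H_D(x,w) · (H_Λ(w,z) if w ∈ Λ, δ_{wz} otherwise)`.
[cite: Lawler1991, §1.4 (strong Markov property)] -/
theorem poissonKernel_decomp (hd : 0 < d) {D Λ : Finset (Site d)} (hDΛ : D ⊆ Λ) {x : Site d}
    (hx : x ∈ D) {z : Site d} (hz : z ∉ Λ) :
    poissonKernel Λ x z = ∑ w ∈ outerBoundary (zdGraph d) D, poissonKernel D x w *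
      (if w ∈ Λ then poissonKernel Λ w z else (if w = z then 1 else 0)) := by
  have hharm := (isZdHarmonicOn_poissonKernel hd Λ hz).mono (Finset.coe_subset.2 hDΛ)
  have key := hharm.eq_sum_poissonKernel hd hx
  simp only [if_pos (hDΛ hx)] at key
  exact key

/-! ### Hitting and escape probabilities -/

section TwoDim

/-- **`P^x{T_V < τ_Λ}`**: the probability that simple random walk from `x` visits `V` before its
first exit from `Λ` — `1` on `V`, `∑_{v ∈ V} H_{Λ∖V}(x,v)` off `V` (so `0` off `Λ ∪ V`). Lawler's
`P^x{τ_A < ξ_m}` with `A = V`, `Λ = C_m`. [cite: Lawler1991, §2.2, Prop. 2.4.1] -/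
def hitBeforeExit (Λ V : Finset (Site d)) (x : Site d) : ℝ :=
  if x ∈ V then 1 else ∑ v ∈ V, poissonKernel (Λ \ V) x v

/-- **`P^x{τ_Λ < T_V}`** `= 1 - P^x{T_V < τ_Λ}`: the probability of leaving `Λ` before visiting
`V` (Lawler's escape probability `e(x, A)` for `x ∉ A`). [cite: Lawler1991, §2.2, Prop. 2.4.1] -/
def exitBeforeHit (Λ V : Finset (Site d)) (x : Site d) : ℝ := 1 - hitBeforeExit Λ V x

/-- `hitBeforeExit = 1` on `V`. [folklore] -/
theorem hitBeforeExit_of_mem (Λ : Finset (Site d)) {V : Finset (Site d)} {x : Site d} (hx : x ∈ V) :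
    hitBeforeExit Λ V x = 1 := by rw [hitBeforeExit, if_pos hx]

/-- `hitBeforeExit` off `V`. [folklore] -/
theorem hitBeforeExit_of_not_mem (Λ : Finset (Site d)) {V : Finset (Site d)} {x : Site d} (hx : x ∉ V) :
    hitBeforeExit Λ V x = ∑ v ∈ V, poissonKernel (Λ \ V) x v := by rw [hitBeforeExit, if_neg hx]

/-- Off `Λ ∪ V` the walk has already left: `hitBeforeExit = 0`. [folklore] -/
theorem hitBeforeExit_of_not_mem_of_not_mem {Λ V : Finset (Site d)} {x : Site d} (hxΛ : x ∉ Λ) (hxV : x ∉ V) :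
    hitBeforeExit Λ V x = 0 := by
  rw [hitBeforeExit_of_not_mem Λ hxV]
  exact Finset.sum_eq_zero fun v _ =>
    poissonKernel_of_not_mem_left _ (fun h => hxΛ (Finset.mem_sdiff.1 h).1) v

/-- `exitBeforeHit = 0` on `V`. [folklore] -/
theorem exitBeforeHit_of_mem (Λ : Finset (Site d)) {V : Finset (Site d)} {x : Site d} (hx : x ∈ V) :
    exitBeforeHit Λ V x = 0 := by rw [exitBeforeHit, hitBeforeExit_of_mem Λ hx, sub_self]

/-- Off `Λ ∪ V` the walk has already left: `exitBeforeHit = 1`. [folklore] -/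
theorem exitBeforeHit_of_not_mem_of_not_mem {Λ V : Finset (Site d)} {x : Site d} (hxΛ : x ∉ Λ) (hxV : x ∉ V) :
    exitBeforeHit Λ V x = 1 := by rw [exitBeforeHit, hitBeforeExit_of_not_mem_of_not_mem hxΛ hxV, sub_zero]

/-- **`hitBeforeExit` is the Poisson extension (into `Λ ∖ V`) of the indicator of `V`.** [folklore] -/
theorem hitBeforeExit_eq_poissonExt (Λ V : Finset (Site d)) (x : Site d) :
    hitBeforeExit Λ V x = poissonExt (Λ \ V) (fun w => if w ∈ V then 1 else 0) x := by
  classical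
  by_cases hxV : x ∈ V
  · rw [hitBeforeExit_of_mem Λ hxV, poissonExt_of_not_mem _ (fun h => (Finset.mem_sdiff.1 h).2 hxV), if_pos hxV]
  · by_cases hxΛ : x ∈ Λ
    · have hx : x ∈ Λ \ V := Finset.mem_sdiff.2 ⟨hxΛ, hxV⟩
      rw [hitBeforeExit_of_not_mem Λ hxV, poissonExt_of_mem _ hx]
      -- `∑_{v ∈ V} H(x,v) = ∑_{z ∈ ∂(Λ∖V)} H(x,z) 𝟙_V(z)`: both reduce to `V ∩ ∂(Λ ∖ V)`
      rw [← Finset.sum_filter_add_sum_filter_not V (fun v => v ∈ outerBoundary (zdGraph d) (Λ \ V))]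
      have h0 : ∑ v ∈ V.filter (fun v => v ∉ outerBoundary (zdGraph d) (Λ \ V)),
          poissonKernel (Λ \ V) x v = 0 := by
        refine Finset.sum_eq_zero fun v hv => ?_
        obtain ⟨hvV, hvb⟩ := Finset.mem_filter.1 hv
        -- `v ∉ ∂(Λ∖V)` and `v ∉ Λ ∖ V`: no neighbour in `Λ ∖ V`
        unfold poissonKernel
        rw [if_neg (fun h => (Finset.mem_sdiff.1 h).2 hvV)]
        refine Finset.sum_eq_zero fun w hw => dirichletGreen_of_not_mem_right _ x fun hwΛ => hvb ?_
        rw [mem_outerBoundary_iff]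
        exact ⟨fun h => (Finset.mem_sdiff.1 h).2 hvV, w, hwΛ, (SimpleGraph.mem_neighborFinset _ _ _).1 hw⟩
      rw [h0, add_zero]
      rw [← Finset.sum_filter_add_sum_filter_not (outerBoundary (zdGraph d) (Λ \ V)) (fun z => z ∈ V)]
      have h1 : ∑ z ∈ (outerBoundary (zdGraph d) (Λ \ V)).filter (fun z => z ∉ V),
          poissonKernel (Λ \ V) x z * (if z ∈ V then 1 else 0) = 0 :=
        Finset.sum_eq_zero fun z hz => by rw [if_neg (Finset.mem_filter.1 hz).2, mul_zero]
      rw [h1, add_zero]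
      have hset : V.filter (fun v => v ∈ outerBoundary (zdGraph d) (Λ \ V)) =
          (outerBoundary (zdGraph d) (Λ \ V)).filter (fun z => z ∈ V) := by
        ext v; simp only [Finset.mem_filter]; tauto
      rw [hset]
      exact Finset.sum_congr rfl fun z hz => by rw [if_pos (Finset.mem_filter.1 hz).2, mul_one]
    · rw [hitBeforeExit_of_not_mem_of_not_mem hxΛ hxV,
        poissonExt_of_not_mem _ (fun h => hxΛ (Finset.mem_sdiff.1 h).1), if_neg hxV]

/-- **`hitBeforeExit Λ V` is harmonic on `Λ ∖ V`** (`d ≥ 1`). [folklore] -/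
theorem isZdHarmonicOn_hitBeforeExit (hd : 0 < d) (Λ V : Finset (Site d)) :
    IsZdHarmonicOn (hitBeforeExit Λ V) (↑(Λ \ V) : Set (Site d)) := by
  have h := isZdHarmonicOn_poissonExt hd (Λ \ V) (fun w => if w ∈ V then 1 else 0)
  have heq : hitBeforeExit Λ V = poissonExt (Λ \ V) (fun w => if w ∈ V then 1 else 0) :=
    funext fun x => hitBeforeExit_eq_poissonExt Λ V x
  rwa [← heq] at h

/-- **`exitBeforeHit Λ V` is harmonic on `Λ ∖ V`** (`d ≥ 1`). [folklore] -/
theorem isZdHarmonicOn_exitBeforeHit (hd : 0 < d) (Λ V : Finset (Site d)) :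
    IsZdHarmonicOn (exitBeforeHit Λ V) (↑(Λ \ V) : Set (Site d)) := by
  have h1 : IsZdHarmonicOn (fun _ : Site d => (1 : ℝ)) (↑(Λ \ V) : Set (Site d)) :=
    fun x _ => latticeLaplacianZd_const 1 x
  exact h1.sub (isZdHarmonicOn_hitBeforeExit hd Λ V)

/-- `0 ≤ hitBeforeExit ≤ 1`. [folklore] -/
theorem hitBeforeExit_mem_Icc (hd : 0 < d) (Λ V : Finset (Site d)) (x : Site d) :
    hitBeforeExit Λ V x ∈ Set.Icc (0 : ℝ) 1 := by
  rw [hitBeforeExit_eq_poissonExt]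
  by_cases hx : x ∈ Λ \ V
  · exact ⟨le_poissonExt hd (fun z _ => by split_ifs <;> norm_num) hx,
      poissonExt_le hd (fun z _ => by split_ifs <;> norm_num) hx⟩
  · rw [poissonExt_of_not_mem _ hx]
    split_ifs <;> norm_num

/-- `0 ≤ exitBeforeHit ≤ 1`. [folklore] -/
theorem exitBeforeHit_mem_Icc (hd : 0 < d) (Λ V : Finset (Site d)) (x : Site d) :
    exitBeforeHit Λ V x ∈ Set.Icc (0 : ℝ) 1 := by
  obtain ⟨h0, h1⟩ := hitBeforeExit_mem_Icc hd Λ V x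
  exact ⟨by rw [exitBeforeHit]; linarith, by rw [exitBeforeHit]; linarith⟩

/-- `0 ≤ exitBeforeHit`. [folklore] -/
theorem exitBeforeHit_nonneg (hd : 0 < d) (Λ V : Finset (Site d)) (x : Site d) : 0 ≤ exitBeforeHit Λ V x :=
  (exitBeforeHit_mem_Icc hd Λ V x).1

/-- `exitBeforeHit ≤ 1`. [folklore] -/
theorem exitBeforeHit_le_one (hd : 0 < d) (Λ V : Finset (Site d)) (x : Site d) : exitBeforeHit Λ V x ≤ 1 :=
  (exitBeforeHit_mem_Icc hd Λ V x).2

/-- `0 ≤ hitBeforeExit`. [folklore] -/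
theorem hitBeforeExit_nonneg (hd : 0 < d) (Λ V : Finset (Site d)) (x : Site d) : 0 ≤ hitBeforeExit Λ V x :=
  (hitBeforeExit_mem_Icc hd Λ V x).1

/-- `hitBeforeExit ≤ 1`. [folklore] -/
theorem hitBeforeExit_le_one (hd : 0 < d) (Λ V : Finset (Site d)) (x : Site d) : hitBeforeExit Λ V x ≤ 1 :=
  (hitBeforeExit_mem_Icc hd Λ V x).2

/-- **`exitBeforeHit` as a sum over the non-`V` exit points**: for `x ∈ Λ ∖ V`,
`exitBeforeHit Λ V x = ∑_{z ∈ ∂(Λ∖V), z ∉ V} H_{Λ∖V}(x,z)`. [folklore] -/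
theorem exitBeforeHit_eq_sum_filter (hd : 0 < d) {Λ V : Finset (Site d)} {x : Site d} (hx : x ∈ Λ \ V) :
    exitBeforeHit Λ V x =
      ∑ z ∈ (outerBoundary (zdGraph d) (Λ \ V)).filter (fun z => z ∉ V), poissonKernel (Λ \ V) x z := by
  classical
  have htot := sum_poissonKernel hd (Λ \ V) hx
  rw [← Finset.sum_filter_add_sum_filter_not (outerBoundary (zdGraph d) (Λ \ V)) (fun z => z ∈ V)] at htot
  have hhit : hitBeforeExit Λ V x = ∑ z ∈ (outerBoundary (zdGraph d) (Λ \ V)).filter (fun z => z ∈ V),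
      poissonKernel (Λ \ V) x z := by
    rw [hitBeforeExit_eq_poissonExt, poissonExt_of_mem _ hx,
      ← Finset.sum_filter_add_sum_filter_not (outerBoundary (zdGraph d) (Λ \ V)) (fun z => z ∈ V)]
    have h1 : ∑ z ∈ (outerBoundary (zdGraph d) (Λ \ V)).filter (fun z => z ∉ V),
        poissonKernel (Λ \ V) x z * (if z ∈ V then 1 else 0) = 0 :=
      Finset.sum_eq_zero fun z hz => by rw [if_neg (Finset.mem_filter.1 hz).2, mul_zero]
    rw [h1, add_zero]
    exact Finset.sum_congr rfl fun z hz => by rw [if_pos (Finset.mem_filter.1 hz).2, mul_one]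
  rw [exitBeforeHit, hhit]
  linarith

/-- **Monotonicity of escape probabilities**: enlarging the domain (`Λ ⊆ Λ'`) or the obstacle
(`V ⊆ V'`) can only decrease the probability of leaving the domain before visiting the obstacle:
`exitBeforeHit Λ' V' ≤ exitBeforeHit Λ V` everywhere (comparison principle on `Λ ∖ V'`). [folklore] -/
theorem exitBeforeHit_mono (hd : 0 < d) {Λ Λ' V V' : Finset (Site d)} (hΛ : Λ ⊆ Λ') (hV : V ⊆ V')
    (x : Site d) : exitBeforeHit Λ' V' x ≤ exitBeforeHit Λ V x := by
  classical
  -- off the common domain `D = Λ ∖ V'` the inequality is immediate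
  by_cases hxV' : x ∈ V'
  · rw [exitBeforeHit_of_mem Λ' hxV']; exact exitBeforeHit_nonneg hd Λ V x
  by_cases hxΛ : x ∈ Λ
  swap
  · have hxV : x ∉ V := fun h => hxV' (hV h)
    rw [exitBeforeHit_of_not_mem_of_not_mem hxΛ hxV]; exact exitBeforeHit_le_one hd Λ' V' x
  -- on `D`: both functions are harmonic, compare boundary values
  set D : Finset (Site d) := Λ \ V' with hD
  have hxD : x ∈ D := Finset.mem_sdiff.2 ⟨hxΛ, hxV'⟩
  have h1 : IsZdHarmonicOn (exitBeforeHit Λ' V') (↑D : Set (Site d)) :=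
    (isZdHarmonicOn_exitBeforeHit hd Λ' V').mono (Finset.coe_subset.2 (Finset.sdiff_subset_sdiff hΛ subset_rfl))
  have h2 : IsZdHarmonicOn (exitBeforeHit Λ V) (↑D : Set (Site d)) :=
    (isZdHarmonicOn_exitBeforeHit hd Λ V).mono (Finset.coe_subset.2 (Finset.sdiff_subset_sdiff subset_rfl hV))
  have hb : ∀ y ∈ zdOuterBoundary (↑D : Set (Site d)), exitBeforeHit Λ' V' y ≤ exitBeforeHit Λ V y + 0 := by
    intro y hy
    rw [add_zero]
    have hyD : y ∉ D := fun h => hy.1 h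
    by_cases hyV' : y ∈ V'
    · rw [exitBeforeHit_of_mem Λ' hyV']; exact exitBeforeHit_nonneg hd Λ V y
    · have hyΛ : y ∉ Λ := fun h => hyD (Finset.mem_sdiff.2 ⟨h, hyV'⟩)
      rw [exitBeforeHit_of_not_mem_of_not_mem hyΛ (fun h => hyV' (hV h))]
      exact exitBeforeHit_le_one hd Λ' V' y
  have key := le_of_sub_super_of_boundary_zd hd D.finite_toSet h1.subharmonicOn h2.superharmonicOn hb x hxD
  rwa [add_zero] at key

/-- The Laplacian of a finite linear combination `x ↦ ∑_{y ∈ s} g(x,y) c(y)`. [folklore] -/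
theorem latticeLaplacianZd_sum_mul (s : Finset (Site d)) (g : Site d → Site d → ℝ) (c : Site d → ℝ)
    (z : Site d) :
    latticeLaplacianZd (fun x => ∑ y ∈ s, g x y * c y) z =
      ∑ y ∈ s, latticeLaplacianZd (fun x => g x y) z * c y := by
  classical
  induction s using Finset.induction_on with
  | empty => simp [latticeLaplacianZd_const]
  | insert a s ha ih =>
    simp only [Finset.sum_insert ha]
    have hsplit : (fun x => g x a * c a + ∑ y ∈ s, g x y * c y) =
        (fun x => c a * g x a) + fun x => ∑ y ∈ s, g x y * c y := by
      funext x; simp only [Pi.add_apply]; ring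
    rw [hsplit, latticeLaplacianZd_add, latticeLaplacianZd_const_mul, ih]
    ring

/-! ### The last-exit decomposition -/

/-- The Laplacian of `hitBeforeExit Λ V` at a point of `V`:
`-Δ hitBeforeExit (x) = ∑_{w ∼ x} exitBeforeHit(w)` (all `2d` neighbours, `hitBeforeExit x = 1`). [folklore] -/
theorem neg_latticeLaplacianZd_hitBeforeExit_of_mem (hd : 0 < d) {Λ V : Finset (Site d)} {x : Site d} (hx : x ∈ V) :
    -latticeLaplacianZd (hitBeforeExit Λ V) x = ∑ w ∈ (zdGraph d).neighborFinset x, exitBeforeHit Λ V w := by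
  rw [latticeLaplacianZd_eq_sum_neighborFinset, hitBeforeExit_of_mem Λ hx]
  rw [← Finset.sum_neg_distrib]
  refine Finset.sum_congr rfl fun w _ => ?_
  have := hd
  rw [exitBeforeHit]; ring

/-- **The last-exit decomposition** (Lawler 1991, Prop. 2.4.1(c)): for `V ⊆ Λ` and `x ∈ Λ`,
`P^x{T_V < τ_Λ} = ∑_{y ∈ V} G_Λ(x,y) · ∑_{w ∼ y} P^w{τ_Λ < T_V}`, i.e.
`hitBeforeExit Λ V x = ∑_{y ∈ V} dirichletGreen Λ x y · ∑_{w ∼ y} exitBeforeHit Λ V w`; at `x ∈ V` the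
left side is `1` ("`∑_y G(x,y) e(y) = 1`", the identity of Prop. 2.4.1(c) on the set itself).
Both sides vanish off `Λ` and have Laplacian `-𝟙_V(x) ∑_{w∼x} exitBeforeHit(w)` on `Λ`; uniqueness.
[cite: Lawler1991, Prop. 2.4.1] -/
theorem hitBeforeExit_eq_sum_dirichletGreen_mul (hd : 0 < d) {Λ V : Finset (Site d)} (hVΛ : V ⊆ Λ)
    {x : Site d} (hx : x ∈ Λ) :
    hitBeforeExit Λ V x = ∑ y ∈ V, dirichletGreen Λ x y *
      ∑ w ∈ (zdGraph d).neighborFinset y, exitBeforeHit Λ V w := by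
  classical
  set E : Site d → ℝ := fun y => ∑ w ∈ (zdGraph d).neighborFinset y, exitBeforeHit Λ V w with hE
  set Dfun : Site d → ℝ := fun x => ∑ y ∈ V, dirichletGreen Λ x y * E y with hDfun
  -- Laplacian of the right side on `Λ`
  have hlapD : ∀ z ∈ Λ, -latticeLaplacianZd Dfun z = if z ∈ V then E z else 0 := by
    intro z hz
    have hlin : latticeLaplacianZd Dfun z = ∑ y ∈ V, latticeLaplacianZd (fun x => dirichletGreen Λ x y) z * E y :=
      latticeLaplacianZd_sum_mul V (fun x y => dirichletGreen Λ x y) E z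
    rw [hlin, ← Finset.sum_neg_distrib]
    have hterm : ∀ y ∈ V, -(latticeLaplacianZd (fun x => dirichletGreen Λ x y) z * E y) =
        (if y = z then 1 else 0) * E y := by
      intro y _
      have hsym : (fun x => dirichletGreen Λ x y) = dirichletGreen Λ y := by
        funext x; exact dirichletGreen_comm Λ x y
      rw [hsym, neg_mul_eq_neg_mul, neg_latticeLaplacianZd_dirichletGreen hd Λ y hz]
    rw [Finset.sum_congr rfl hterm]
    by_cases hzV : z ∈ V
    · rw [if_pos hzV, Finset.sum_eq_single_of_mem z hzV fun y _ hyz => by rw [if_neg hyz, zero_mul]]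
      rw [if_pos rfl, one_mul]
    · rw [if_neg hzV]
      exact Finset.sum_eq_zero fun y hy => by rw [if_neg (by rintro rfl; exact hzV hy), zero_mul]
  -- Laplacian of the left side on `Λ`
  have hlapH : ∀ z ∈ Λ, -latticeLaplacianZd (hitBeforeExit Λ V) z = if z ∈ V then E z else 0 := by
    intro z hz
    by_cases hzV : z ∈ V
    · rw [if_pos hzV]; exact neg_latticeLaplacianZd_hitBeforeExit_of_mem hd hzV
    · rw [if_neg hzV, isZdHarmonicOn_hitBeforeExit hd Λ V z (Finset.mem_coe.2 (Finset.mem_sdiff.2 ⟨hz, hzV⟩)),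
        neg_zero]
  -- both vanish off `Λ`
  have hoffD : ∀ z ∉ Λ, Dfun z = 0 := fun z hz =>
    Finset.sum_eq_zero fun y _ => by rw [dirichletGreen_of_not_mem_left Λ hz, zero_mul]
  have hoffH : ∀ z ∉ Λ, hitBeforeExit Λ V z = 0 := fun z hz =>
    hitBeforeExit_of_not_mem_of_not_mem hz (fun h => hz (hVΛ h))
  -- uniqueness
  have hharm : IsZdHarmonicOn (fun z => hitBeforeExit Λ V z - Dfun z) (↑Λ : Set (Site d)) := by
    intro z hz
    have hz' := Finset.mem_coe.1 hz
    have hsub := latticeLaplacianZd_sub (hitBeforeExit Λ V) Dfun z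
    rw [show (fun z => hitBeforeExit Λ V z - Dfun z) = hitBeforeExit Λ V - Dfun from rfl, hsub]
    have h1 := hlapH z hz'
    have h2 := hlapD z hz'
    linarith
  have hzero : IsZdHarmonicOn (fun _ : Site d => (0 : ℝ)) (↑Λ : Set (Site d)) :=
    fun w _ => latticeLaplacianZd_const 0 w
  have hb : ∀ w ∈ zdOuterBoundary (↑Λ : Set (Site d)),
      (fun z => hitBeforeExit Λ V z - Dfun z) w = (fun _ : Site d => (0 : ℝ)) w := by
    intro w hw
    have hw' : w ∉ Λ := fun h => hw.1 h
    simp only [hoffH w hw', hoffD w hw', sub_zero]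
  have key := hharm.eq_of_eq_boundary hd Λ.finite_toSet hzero hb hx
  simp only at key
  linarith

/-- **Last-exit decomposition at a point of `V`**: `∑_{y ∈ V} G_Λ(x,y) ∑_{w∼y} exitBeforeHit Λ V w = 1`
for `x ∈ V ⊆ Λ`. [cite: Lawler1991, Prop. 2.4.1] -/
theorem sum_dirichletGreen_mul_escape_eq_one (hd : 0 < d) {Λ V : Finset (Site d)} (hVΛ : V ⊆ Λ)
    {x : Site d} (hx : x ∈ V) :
    ∑ y ∈ V, dirichletGreen Λ x y * ∑ w ∈ (zdGraph d).neighborFinset y, exitBeforeHit Λ V w = 1 := by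
  rw [← hitBeforeExit_eq_sum_dirichletGreen_mul hd hVΛ (hVΛ hx), hitBeforeExit_of_mem Λ hx]

end TwoDim

end Literature.Probability.LatticeModels

end
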